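import Summits.NavierStokesRegularity.NavierStokesRegularity.Theorems.TypeICertificateLadderRungReynoldsOneOseenGauge
import Literature.Analysis.FluidPDE.KNSSTypeIRateMildBridge
import HarnessLib

/-!
# Route TypeICertificateLadder — the Leray rate `limsup_{t↑T} √((T−t)/ν)‖u(t)‖_∞ ≥ 1` in the
  OSEEN GAUGE for a general viscosity `ν > 0` (C31-M of cell pub-ns-dss, classical rendering,
  ν-units; helper of crux stmt-NavierStokesRegularity-2882)

The unit-viscosity statement `lerayRate_frequently_gt_of_oseenMild`
(`TypeICertificateLadderRungReynoldsOneOseenGauge.lean`) transported along the viscosity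
normalisation `ũ(s, x) = ν⁻¹ u(s/ν, x)` (KNSS 2009, §1 (1.1): "`ν = 1` by rescaling"; Tao 2013,
footnote 3): `IsClassicalNSSolutionOn.viscosityRescale_set` for the equations, and the Duhamel
identity `B¹_{νs}(ũ, ũ)(νt) = ν⁻¹ B^ν_s(u, u)(t)` (`oseenDuhamel_one_timeRescale`) for the Oseen gauge.
For a classical solution `(u, p)` of unforced Navier–Stokes with viscosity `ν` on `ℝ³ × (0, T)`,
bounded on every `(0,T') × ℝ³` (`T' < T`), satisfying
`u(t) = e^{ν(t−s)Δ}u(s) − B^ν_s(u,u)(t)` pointwise between all pairs `0 < s < t < T`, and unbounded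
on `(0,T) × ℝ³`: for every `θ < 1`, `θ√ν < √(T−t)‖u(t,x)‖` for some `x`, frequently as `t ↑ T`
(`lerayRate_frequently_gt_of_oseenMild_viscosity`).

HONEST FRAMING: a statement about a HYPOTHETICAL singular time; nothing is said at or above the
threshold; nothing here bears on the regularity question itself.
-/

noncomputable section

namespace Summit.NavierStokesRegularity.NavierStokesRegularity.Theorems

set_option linter.dupNamespace false

open MeasureTheory Set Filter Topology Function
open scoped RealInnerProductSpace
open Literature.Analysis Literature.Analysis.FluidPDE

/-- **The Oseen gauge under the viscosity normalisation**: if `u` satisfies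
`u(t) = e^{ν(t−s)Δ}u(s) − B^ν_s(u,u)(t)` at every point for some `s ≤ t`, then
`ũ = timeRescale ν⁻¹ ν⁻¹ u` (`ũ(σ, x) = ν⁻¹ u(σ/ν, x)`) satisfies
`ũ(νt) = e^{(νt−νs)Δ}ũ(νs) − B¹_{νs}(ũ, ũ)(νt)` (the converse of the tree's
`oseen_of_oseen_timeRescale`; `oseenDuhamel_one_timeRescale`, `heatExtension_const_smul`).
[cite: KochNadirashviliSereginSverak2009, §1 (1.1) (arXiv p. 2)] -/
theorem oseen_timeRescale_of_oseen {ν : ℝ} (hν : 0 < ν)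
    {u : ℝ → EuclideanSpace ℝ (Fin 3) → EuclideanSpace ℝ (Fin 3)} {s t : ℝ} (hst : s ≤ t)
    (h : ∀ x, u t x = UnboundedOperators.heatExtension (u s) (ν * (t - s)) x - oseenDuhamel ν s u u t x)
    (x : EuclideanSpace ℝ (Fin 3)) :
    timeRescale ν⁻¹ ν⁻¹ u (ν * t) x =
      UnboundedOperators.heatExtension (timeRescale ν⁻¹ ν⁻¹ u (ν * s)) (ν * t - ν * s) x -
        oseenDuhamel 1 (ν * s) (timeRescale ν⁻¹ ν⁻¹ u) (timeRescale ν⁻¹ ν⁻¹ u) (ν * t) x := by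
  have hν0 : ν ≠ 0 := hν.ne'
  rw [oseenDuhamel_one_timeRescale hν u hst x, timeRescale_apply, timeRescale_slice,
    UnboundedOperators.heatExtension_const_smul, show ν⁻¹ * (ν * t) = t by field_simp,
    show ν⁻¹ * (ν * s) = s by field_simp, show ν * t - ν * s = ν * (t - s) by ring, ← smul_sub, h x]

/-- **C31-M in ν-units (classical rendering): `limsup_{t↑T} √((T−t)/ν)‖u(t)‖_∞ ≥ 1` in the Oseen
gauge.** Let `(u, p)` be a classical solution of unforced Navier–Stokes with viscosity `ν > 0` on
`ℝ³ × (0,T)`, `T > 0`, bounded on every `(0,T') × ℝ³` (`T' < T`), satisfying the Oseen integral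
equation `u(t) = e^{ν(t−s)Δ}u(s) − B^ν_s(u,u)(t)` between all pairs of times of `(0,T)`, and
unbounded on `(0,T) × ℝ³`. Then for every `θ < 1`: `θ√ν < √(T−t)‖u(t,x)‖` for some `x`,
frequently as `t ↑ T`. Proof: the normalised field `ũ(σ,x) = ν⁻¹u(σ/ν,x)` on `(0, νT)` satisfies
the hypotheses of `lerayRate_frequently_gt_of_oseenMild` (`viscosityRescale_set`,
`oseen_timeRescale_of_oseen`), and `𝓝[<](νT)` is the image of `𝓝[<]T` under `t ↦ νt`. NO energy
inequality, NO datum decay, NO Leray–Hopf structure; nothing at or above the threshold.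
[this file; KNSS 2009 §1 (1.1), §4, §6 + pub-ns-dss T31⁗] -/
theorem lerayRate_frequently_gt_of_oseenMild_viscosity {ν T : ℝ} (hν : 0 < ν) (hT : 0 < T)
    {u : ℝ → EuclideanSpace ℝ (Fin 3) → EuclideanSpace ℝ (Fin 3)}
    {p : ℝ → EuclideanSpace ℝ (Fin 3) → ℝ}
    (hcl : IsClassicalNSSolutionOn (Ioo 0 T) ν 0 u p)
    (hbdd : ∀ T' < T, ∃ M : ℝ, ∀ t ∈ Ioo 0 T', ∀ x, ‖u t x‖ ≤ M)
    (hoseen : ∀ s t : ℝ, 0 < s → s < t → t < T → ∀ X,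
      u t X = UnboundedOperators.heatExtension (u s) (ν * (t - s)) X - oseenDuhamel ν s u u t X)
    (hunb : ∀ M : ℝ, ∃ t ∈ Ioo 0 T, ∃ x, M < ‖u t x‖) {θ : ℝ} (hθ : θ < 1) :
    ∃ᶠ t in 𝓝[<] T, ∃ x, θ * Real.sqrt ν < Real.sqrt (T - t) * ‖u t x‖ := by
  have hν0 : ν ≠ 0 := hν.ne'
  have hνinv : 0 < ν⁻¹ := inv_pos.2 hν
  set v : ℝ → EuclideanSpace ℝ (Fin 3) → EuclideanSpace ℝ (Fin 3) := timeRescale ν⁻¹ ν⁻¹ u with hvdef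
  set q : ℝ → EuclideanSpace ℝ (Fin 3) → ℝ := timeRescale ν⁻¹ (ν ^ 2)⁻¹ p with hqdef
  -- the normalised solution on `(0, νT)`
  have hmaps : MapsTo (fun r => ν⁻¹ * r) (Ioo 0 (ν * T)) (Ioo 0 T) :=
    fun r hr => (inv_mul_mem_Ioo_iff hν).2 hr
  have hclv : IsClassicalNSSolutionOn (Ioo 0 (ν * T)) 1 0 v q := by
    simpa using hcl.viscosityRescale_set hν0 hmaps isOpen_Ioo.uniqueDiffOn
  have hv : ∀ σ x, v σ x = ν⁻¹ • u (ν⁻¹ * σ) x := fun σ x => rfl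
  have hbddv : ∀ S' < ν * T, ∃ M : ℝ, ∀ σ ∈ Ioo 0 S', ∀ x, ‖v σ x‖ ≤ M := by
    intro S' hS'
    obtain ⟨M, hM⟩ := hbdd (ν⁻¹ * S') (by
      rw [inv_mul_lt_iff₀ hν]; exact hS')
    refine ⟨ν⁻¹ * M, fun σ hσ x => ?_⟩
    rw [hv, norm_smul, Real.norm_of_nonneg hνinv.le]
    exact mul_le_mul_of_nonneg_left (hM _ ⟨mul_pos hνinv hσ.1, mul_lt_mul_of_pos_left hσ.2 hνinv⟩ x)
      hνinv.le
  have hoseenv : ∀ σ τ : ℝ, 0 < σ → σ < τ → τ < ν * T → ∀ X,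
      v τ X = UnboundedOperators.heatExtension (v σ) (τ - σ) X - oseenDuhamel 1 σ v v τ X := by
    intro σ τ hσ hστ hτ X
    have hs : 0 < ν⁻¹ * σ := mul_pos hνinv hσ
    have hst : ν⁻¹ * σ < ν⁻¹ * τ := mul_lt_mul_of_pos_left hστ hνinv
    have ht : ν⁻¹ * τ < T := by rw [inv_mul_lt_iff₀ hν]; exact hτ
    have key := oseen_timeRescale_of_oseen hν hst.le (hoseen _ _ hs hst ht) X
    rw [show ν * (ν⁻¹ * τ) = τ by field_simp, show ν * (ν⁻¹ * σ) = σ by field_simp] at key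
    exact key
  have hunbv : ∀ M : ℝ, ∃ σ ∈ Ioo 0 (ν * T), ∃ x, M < ‖v σ x‖ := by
    intro M
    obtain ⟨t, ht, x, hx⟩ := hunb (ν * M)
    refine ⟨ν * t, ⟨mul_pos hν ht.1, mul_lt_mul_of_pos_left ht.2 hν⟩, x, ?_⟩
    rw [hv, show ν⁻¹ * (ν * t) = t by field_simp, norm_smul, Real.norm_of_nonneg hνinv.le,
      lt_inv_mul_iff₀ hν]
    exact hx
  -- the unit-viscosity theorem at time `νT`
  have h1 := lerayRate_frequently_gt_of_oseenMild (mul_pos hν hT) hclv hbddv hoseenv hunbv hθ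
  -- transport `𝓝[<](νT) = map (ν * ·) (𝓝[<] T)`
  have hemb : IsEmbedding fun t : ℝ => ν * t := (Homeomorph.mulLeft₀ ν hν0).isEmbedding
  have hmap : map (fun t : ℝ => ν * t) (𝓝[<] T) = 𝓝[<] (ν * T) := by
    rw [hemb.map_nhdsWithin_eq, Set.image_mul_left_Iio hν T]
  rw [← hmap, Filter.frequently_map] at h1
  refine h1.mono fun t ⟨x, hx⟩ => ⟨x, ?_⟩
  rw [hv, show ν⁻¹ * (ν * t) = t by field_simp, norm_smul, Real.norm_of_nonneg hνinv.le,
    show ν * T - ν * t = ν * (T - t) by ring] at hx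
  have hsν : 0 < Real.sqrt ν := Real.sqrt_pos.2 hν
  -- `√(ν(T−t)) ν⁻¹ ‖u‖ = √(T−t)‖u‖/√ν`
  rcases le_or_gt (T - t) 0 with hle | hgt
  · -- degenerate times `t ≥ T` carry no information but the inequality still transports
    have : Real.sqrt (ν * (T - t)) = 0 := Real.sqrt_eq_zero'.2 (mul_nonpos_of_nonneg_of_nonpos hν.le hle)
    rw [this, zero_mul] at hx
    have hT0 : Real.sqrt (T - t) = 0 := Real.sqrt_eq_zero'.2 hle
    rw [hT0, zero_mul]
    nlinarith [hsν]
  · rw [Real.sqrt_mul hν.le] at hx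
    have hsq : Real.sqrt ν ^ 2 = ν := Real.sq_sqrt hν.le
    have e : Real.sqrt ν * Real.sqrt (T - t) * (ν⁻¹ * ‖u t x‖) =
        (Real.sqrt (T - t) * ‖u t x‖) / Real.sqrt ν := by
      rw [eq_div_iff hsν.ne']
      calc Real.sqrt ν * Real.sqrt (T - t) * (ν⁻¹ * ‖u t x‖) * Real.sqrt ν
          = (Real.sqrt ν ^ 2 * ν⁻¹) * (Real.sqrt (T - t) * ‖u t x‖) := by ring
        _ = Real.sqrt (T - t) * ‖u t x‖ := by rw [hsq, mul_inv_cancel₀ hν0, one_mul]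
    rw [e, lt_div_iff₀ hsν] at hx
    exact hx

end Summit.NavierStokesRegularity.NavierStokesRegularity.Theorems

end
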